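import Summits.ValiantsHypothesis.ValiantsHypothesis.Theorems.LacunarySymmetroidMatrixDescartesCensusDoorA34NullEndLift

/-!
# `MatrixDescartes` census — DOOR A at `(3,4)`: the ISOTROPIC-CORNER law (the deepest clean sheet of the descending flag is ALL-MIDDLE)

HONEST FRAMING.  Object-search cell `pub-symmetroid`, engine seat `val-sym-eng-2` (g2); helper file beside the registered strata line
`Cruxes/DoorA34/Lines/strata.lean` on stmt-ValiantsHypothesis-19980 (`DoorA34 = PosRootLawAt 3 4 18`: OPEN, typed, never asserted here).
Three steps down the descending flag of end coefficients below the null-top stratum (`det S₃ = 0`, then `tr(adj S₃·S₂) = 0`,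
`tr(adj S₃·S₁) = 0`, `tr(adj S₃·S₀) = 0`; companions `…SubStratumLift`, `…SubStratumSixteen`, `…SubSubStratumFifteen`) the kernel vector
`k` of the rank-two top letter is ISOTROPIC FOR THE WHOLE CORE NET: in a frame with `k = e₃` every letter has a zero corner,
`(S l)₂₂ = 0`, so the pencil `F(t)` itself has `F(t)₂₂ = 0` for all `t` and `det F = −cᵀ adj(A) c` is a quadratic form in the border
`c = (F₀₂, F₁₂)` with the `2 × 2` block `A`.  This file records the one structural fact that sheet offers for free:

* `det_fin_three_of_corner_eq_zero` — `det M = −(M₀₀ M₁₂² − 2 M₀₁ M₀₂ M₁₂ + M₁₁ M₀₂²)` for a symmetric `3 × 3` matrix with `M₂₂ = 0`;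
* `trace_adjugate_of_corner_eq_zero` — `tr(adj M) = (M₀₀ M₁₁ − M₀₁²) − M₀₂² − M₁₂²` there;
* `trace_adjugate_neg_of_isotropic_corner` — **ISOTROPIC CORNER ⇒ MIDDLE TYPE**: a real symmetric `3 × 3` matrix with `M₂₂ = 0`,
  `det M = 0` and non-zero border `(M₀₂, M₁₂) ≠ 0` has `tr(adj M) < 0`, i.e. its two non-zero eigenvalues have OPPOSITE signs (the
  cell's «middle type», `…CensusDoorA34RootType` / `…FlagLaw`): a definite `2 × 2` block `A` would make `cᵀ adj(A) c ≠ 0`;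
* `trace_adjugate_eval_neg_of_isotropic_core` — pencil form: if every letter has `(S l)₂₂ = 0`, then at every real `t` where
  `det F(t) = 0` and the border of `F(t)` is non-zero, `tr(adj F(t)) < 0` — EVERY such determinant root is of middle type.  So on the
  isotropic-core sheet the all-middle hypothesis of the cell's flag law (`…CensusDoorA34FlagLaw`: at most `4` flag roots past a
  middle-type root) holds at every root, and door-p3's located «ALL-MIDDLE» question (DOOR-A34-P3G11 §3) is answered there outright.

NOTHING here bounds a root count; nothing asserts that objects on that sheet exist; `DoorA34`, both stubs and the registers
(`18 ≤ ζ_sym(3,4) ≤ 19`) are unchanged; nothing bears on `MatrixDescartes` (stmt-ValiantsHypothesis-18050) or `VP ≠ VNP` — VP≠VNP not moved.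

[folklore] Schur complement of a zero corner; signs of `2 × 2` quadratic forms.
-/

-- `Summit.ValiantsHypothesis.ValiantsHypothesis.…` repeats a component by the D-0017 layout
-- (single-conjunct summit), which the `dupNamespace` linter flags; the name is mandated.
set_option linter.dupNamespace false

namespace Summit.ValiantsHypothesis.ValiantsHypothesis.Theorems.LacunarySymmetroidMatrixDescartes.Census

open Polynomial Finset
open scoped BigOperators Polynomial Matrix

/-- Determinant of a symmetric `3 × 3` matrix with zero corner `M₂₂ = 0`: minus the adjugate quadratic form of the `2 × 2` block on
the border. [folklore] -/
theorem det_fin_three_of_corner_eq_zero (M : Matrix (Fin 3) (Fin 3) ℝ) (hM : M.IsSymm) (h22 : M 2 2 = 0) :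
    M.det = -(M 0 0 * M 1 2 ^ 2 - 2 * M 0 1 * M 0 2 * M 1 2 + M 1 1 * M 0 2 ^ 2) := by
  have h10 : M 1 0 = M 0 1 := by simpa using hM.apply 0 1
  have h20 : M 2 0 = M 0 2 := by simpa using hM.apply 0 2
  have h21 : M 2 1 = M 1 2 := by simpa using hM.apply 1 2
  rw [Matrix.det_fin_three, h10, h20, h21, h22]
  ring

/-- Trace of the adjugate of a symmetric `3 × 3` matrix with zero corner: `det` of the `2 × 2` block minus the squared border.
[folklore] -/
theorem trace_adjugate_of_corner_eq_zero (M : Matrix (Fin 3) (Fin 3) ℝ) (hM : M.IsSymm) (h22 : M 2 2 = 0) :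
    M.adjugate.trace = (M 0 0 * M 1 1 - M 0 1 ^ 2) - M 0 2 ^ 2 - M 1 2 ^ 2 := by
  have h10 : M 1 0 = M 0 1 := by simpa using hM.apply 0 1
  have h20 : M 2 0 = M 0 2 := by simpa using hM.apply 0 2
  have h21 : M 2 1 = M 1 2 := by simpa using hM.apply 1 2
  rw [Matrix.trace_fin_three, Matrix.adjugate_fin_three]
  simp only [Matrix.of_apply, Matrix.cons_val', Matrix.cons_val_zero, Matrix.cons_val_one, Matrix.cons_val_two,
    Matrix.empty_val', Matrix.cons_val_fin_one, Matrix.head_cons, Matrix.tail_cons, Matrix.head_fin_const]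
  rw [h10, h20, h21, h22]
  ring

/-- **ISOTROPIC CORNER ⇒ MIDDLE TYPE.**  A real symmetric `3 × 3` matrix with `M₂₂ = 0` (the corner vector `e₂` is isotropic),
`det M = 0` and non-zero border `(M₀₂, M₁₂) ≠ (0, 0)` has `tr(adj M) < 0`: its two non-zero eigenvalues have opposite signs.
(If the border vanishes, `e₂` is the kernel vector and the type is that of the `2 × 2` block — unrestricted.) [folklore] -/
theorem trace_adjugate_neg_of_isotropic_corner (M : Matrix (Fin 3) (Fin 3) ℝ) (hM : M.IsSymm) (h22 : M 2 2 = 0)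
    (hdet : M.det = 0) (hb : M 0 2 ≠ 0 ∨ M 1 2 ≠ 0) : M.adjugate.trace < 0 := by
  rw [trace_adjugate_of_corner_eq_zero M hM h22]
  rw [det_fin_three_of_corner_eq_zero M hM h22] at hdet
  set a := M 0 0
  set b := M 0 1
  set d := M 1 1
  set u := M 0 2
  set v := M 1 2
  -- the adjugate quadratic form of the block vanishes on the border: `a v² − 2 b u v + d u² = 0`
  have hQ : a * v ^ 2 - 2 * b * u * v + d * u ^ 2 = 0 := by linarith
  -- completing squares: `a·Q = (a v − b u)² + (a d − b²) u²`, `d·Q = (d u − b v)² + (a d − b²) v²`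
  have e1 : a * (a * v ^ 2 - 2 * b * u * v + d * u ^ 2) = (a * v - b * u) ^ 2 + (a * d - b ^ 2) * u ^ 2 := by ring
  have e2 : d * (a * v ^ 2 - 2 * b * u * v + d * u ^ 2) = (d * u - b * v) ^ 2 + (a * d - b ^ 2) * v ^ 2 := by ring
  rw [hQ, mul_zero] at e1 e2
  have h1 : (a * d - b ^ 2) * u ^ 2 ≤ 0 := by nlinarith [sq_nonneg (a * v - b * u)]
  have h2 : (a * d - b ^ 2) * v ^ 2 ≤ 0 := by nlinarith [sq_nonneg (d * u - b * v)]
  have hpos : 0 < u ^ 2 + v ^ 2 := by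
    rcases hb with hu | hv
    · have := pow_pos (abs_pos.mpr hu) 2; rw [sq_abs] at this; positivity
    · have := pow_pos (abs_pos.mpr hv) 2; rw [sq_abs] at this; positivity
  have hdet2 : (a * d - b ^ 2) * (u ^ 2 + v ^ 2) ≤ 0 := by nlinarith
  have hnonpos : a * d - b ^ 2 ≤ 0 := by
    by_contra h
    rw [not_le] at h
    exact absurd hdet2 (not_le.mpr (mul_pos h hpos))
  nlinarith

/-! ## Pencil form: on the isotropic-core sheet every determinant root (off the border-vanishing locus) is of middle type -/

/-- evaluation of a `(3,4)` pencil at a real point, entrywise. [folklore] -/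
theorem pencil_map_eval_apply (d : Fin 4 → ℕ) (S : Fin 4 → Matrix (Fin 3) (Fin 3) ℝ) (t : ℝ) (i j : Fin 3) :
    ((∑ l, (X : ℝ[X]) ^ d l • (S l).map C).map (eval t)) i j = ∑ l, t ^ d l * S l i j := by
  rw [Matrix.map_apply, Matrix.sum_apply, Polynomial.eval_finsetSum]
  refine Finset.sum_congr rfl fun l _ => ?_
  rw [Matrix.smul_apply, Matrix.map_apply, smul_eq_mul, Polynomial.eval_mul, Polynomial.eval_pow, Polynomial.eval_X,
    Polynomial.eval_C]

/-- **ISOTROPIC-CORE SHEET IS ALL-MIDDLE.**  If every letter of a real symmetric `(3,4)` pencil has zero corner `(S l)₂₂ = 0`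
(`e₂` isotropic for the whole net — three steps down the descending flag below `det S₃ = 0` in a frame with kernel vector `e₂`),
then at every real `t` where the determinant vanishes and the border `(F(t)₀₂, F(t)₁₂)` is non-zero, `tr(adj F(t)) < 0`: the root is
of MIDDLE type. [folklore] -/
theorem trace_adjugate_eval_neg_of_isotropic_core (d : Fin 4 → ℕ) (S : Fin 4 → Matrix (Fin 3) (Fin 3) ℝ)
    (hS : ∀ l, (S l).IsSymm) (hcorner : ∀ l, S l 2 2 = 0) (t : ℝ)
    (hroot : ((∑ l, (X : ℝ[X]) ^ d l • (S l).map C).map (eval t)).det = 0)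
    (hb : ((∑ l, (X : ℝ[X]) ^ d l • (S l).map C).map (eval t)) 0 2 ≠ 0 ∨
      ((∑ l, (X : ℝ[X]) ^ d l • (S l).map C).map (eval t)) 1 2 ≠ 0) :
    (((∑ l, (X : ℝ[X]) ^ d l • (S l).map C).map (eval t)).adjugate).trace < 0 := by
  set M : Matrix (Fin 3) (Fin 3) ℝ := ((∑ l, (X : ℝ[X]) ^ d l • (S l).map C).map (eval t)) with hMdef
  have hM : M.IsSymm := by
    unfold Matrix.IsSymm
    ext i j
    rw [Matrix.transpose_apply, hMdef, pencil_map_eval_apply, pencil_map_eval_apply]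
    refine Finset.sum_congr rfl fun l _ => ?_
    rw [show S l j i = S l i j from by simpa using (hS l).apply i j]
  have h22 : M 2 2 = 0 := by
    rw [hMdef, pencil_map_eval_apply]
    exact Finset.sum_eq_zero fun l _ => by rw [hcorner l, mul_zero]
  exact trace_adjugate_neg_of_isotropic_corner M hM h22 hroot hb

end Summit.ValiantsHypothesis.ValiantsHypothesis.Theorems.LacunarySymmetroidMatrixDescartes.Census
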